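import Summits.Langlands.Langlands.Theses.IrreducibilityBySelfDuality
import Summits.Langlands.Langlands.Theorems.IrreducibilityBySelfDualityIrreducibleOffSectorRankTwoRegularNoPole
import Summits.Langlands.Langlands.Theorems.IrreducibilityBySelfDualityWeakAbelianSummandHecke
import HarnessLib

/-!
# The rank-two regular slice of `IrreducibleOffSector`, on the route's decls
(crux stmt-Langlands-14329 `IrreducibilityBySelfDuality.IrreducibleOffSector`, line `Sketch`;
`--supports` file naming the route decls — it imports the Theses file and is therefore NOT for use
inside `closes`; the structural form is `isIrreducible_rank_two_of_isRegular_of_boundary` of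
`…IrreducibleOffSectorRankTwoRegularNoPole`)

`irreducibleOffSector_rank_two_of_isRegular` — the crux `IrreducibleOffSector` restricted to `n = 2`
and to `π` with a regular infinity type holds GIVEN only the route's two open INPUT items
`PairLBoundaryJS` (stmt-Langlands-13622, Arthur–Clozel (2.2)) and `HeckeEigenvalueField`
(stmt-Langlands-13632, Clozel 1990 Thm. 3.13): the Böckle–Hui input `WeakAbelianSummandHecke`
(stmt-Langlands-13620) is a THEOREM of the tree (`WeakAbelianSummandHecke_proof`) and is fed here, and
Arthur–Clozel (2.3) enters only in rank one, where it is Hecke's theorem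
(`JacquetShalika1981_partialPairL_pole_repData_one`, inside `isIrreducible_rank_two_of_isRegular_of_boundary`).
No reciprocity / existence hypothesis on Galois representations enters: over fields where no
compatible `ρ` exists the statement is vacuous, and wherever one exists (totally real `K`:
Carayol, Taylor, Blasius–Rogawski; CM `K`: Harris–Lan–Taylor–Thorne, Scholze) it is irreducible.

References: G. Böckle, C. Y. Hui (2025), Thm. 1.1 and §3.2.1; K. Ribet, LNM 601 (1977), Thm. 2.3;
R. Taylor, Invent. Math. 98 (1989) / (1995); H. Jacquet, J. Shalika, Amer. J. Math. 103 (1981) II,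
Thm. 4.4.
-/

noncomputable section

set_option linter.dupNamespace false

open scoped NumberField
open Filter IsDedekindDomain
open Literature.NumberTheory.Automorphic Literature.NumberTheory.GaloisRepresentations
open Summit.Langlands
open Summit.Langlands.Langlands.Theses.IrreducibilityBySelfDuality

namespace Summit.Langlands.Langlands.Theorems.IrreducibleOffSector

/-- **`IrreducibleOffSector` in rank two for regular `π`, from the route inputs `PairLBoundaryJS`,
`HeckeEigenvalueField`** (both open; formalization debt): for every number field `K`, every cuspidal `π` on
`GL_2(𝔸_K)`, L-algebraic with a regular infinity type, every `ℓ`, `ι` and every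
`ρ : Γ_K → GL_2(ℚ̄_ℓ)` Satake–Frobenius compatible with `(π, ι)` at almost all places, `ρ` is
irreducible (`isIrreducible_rank_two_of_isRegular_of_boundary` fed with the proved item
`WeakAbelianSummandHecke_proof`; `PairLBoundaryJS` is definitionally Arthur–Clozel (2.2) for
Borel–Jacquet data). [cite: BockleHui2025, Theorem 1.1 and §3.2.1] -/
theorem irreducibleOffSector_rank_two_of_isRegular (i4 : PairLBoundaryJS) (i6 : HeckeEigenvalueField)
    {K : Type} [Field K] [NumberField K] {hcpt : isCompact_glFiniteIntegralLevel 2 K}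
    (π : CuspidalAutomorphicRepData 2 K hcpt) (hL : π.1.IsLAlgebraic)
    (hreg : ∃ T : InfinityType K 2, π.1.HasInfinityType T ∧ T.IsRegular)
    {ℓ : ℕ} [Fact ℓ.Prime] (ι : PadicAlgCl ℓ ≃+* ℂ) (ρ : FramedGaloisRep K (PadicAlgCl ℓ) 2)
    (hρ : ∀ᶠ v : HeightOneSpectrum (𝓞 K) in cofinite, SatakeFrobCompatibleAt ι π.1 ρ v) :
    ρ.toGaloisRep.IsIrreducible :=
  isIrreducible_rank_two_of_isRegular_of_boundary
    Summit.Langlands.Langlands.Theorems.WeakAbelianSummandHecke_proof i6 i4 π hL hreg ι ρ hρ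

/-- **The rank-two regular region of the crux, in the crux's own shape**: the text of
`IrreducibleOffSector` with `n` specialised to `2` and the regularity of an infinity type of `π`
added, from `PairLBoundaryJS` and `HeckeEigenvalueField` (the sector clause is vacuous in rank `2`). [cite: BockleHui2025, Theorem 1.1 and §3.2.1] -/
theorem irreducibleOffSector_text_rank_two_of_isRegular (i4 : PairLBoundaryJS) (i6 : HeckeEigenvalueField) :
    ∀ (K : Type) [Field K] [NumberField K]
      (hcpt : Literature.NumberTheory.Automorphic.isCompact_glFiniteIntegralLevel 2 K), 0 < 2 →
      ∀ (π : Literature.NumberTheory.Automorphic.CuspidalAutomorphicRepData 2 K hcpt), π.1.IsLAlgebraic →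
      (∃ T : Literature.NumberTheory.Automorphic.InfinityType K 2, π.1.HasInfinityType T ∧ T.IsRegular) →
      ¬ (2 = 3 ∧ NumberField.IsCMField K ∧
          ∃ T : Literature.NumberTheory.Automorphic.InfinityType K 2, π.1.HasInfinityType T ∧ T.IsRegular) →
      ∀ (ℓ : ℕ) [Fact ℓ.Prime] (ι : PadicAlgCl ℓ ≃+* ℂ)
        (ρ : Literature.NumberTheory.GaloisRepresentations.FramedGaloisRep K (PadicAlgCl ℓ) 2),
        (∀ᶠ v : IsDedekindDomain.HeightOneSpectrum (NumberField.RingOfIntegers K) in cofinite,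
          SatakeFrobCompatibleAt ι π.1 ρ v) → ρ.toGaloisRep.IsIrreducible :=
  fun _K _ _ _hcpt _ π hL hreg _ _ℓ _ ι ρ hρ =>
    irreducibleOffSector_rank_two_of_isRegular i4 i6 π hL hreg ι ρ hρ

end Summit.Langlands.Langlands.Theorems.IrreducibleOffSector

end
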